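import Literature.NumberTheory.Li1992.RallisLocalFactorSplitGeneralOfSplit
import HarnessLib

/-!
# [Li1992, Thm 2.1 (27) / §5] — the local matrix coefficients `⟨ω_v(h·1_N)Φ, Φ'⟩` of the rank-one member are integrable over
# `U(J₁)(F_v)` at EVERY finite place, for GENERAL test vectors

Sequel of `RallisLocalFactorSplitGeneralOfSplit.lean` (the SPLIT places).  At a NON-SPLIT place `v` of `F` (the place `w ∣ v` of `E` is fixed
by `c`) the torus `U(J₁)(F_v) = E_v¹` is COMPACT (★ `compactSpace_localPi_one_of_smul_eq`) and the coefficient `h ↦ ⟨ω_v(h·1_N)Φ, Φ'⟩` is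
locally constant (`ω_v` smooth, ★ `isSmooth_omegaLoc`), hence integrable for every measure finite on compacts — no isometry, no Darboux data.
Together:

* `integrable_localCoeff_of_nonsplit` — the non-split places;
* **`integrable_localCoeff`** — at EVERY finite place `v` of `F` (`c ≠ 1`, `J₁` hermitian with `J₁ 0 0 ≠ 0`, `N ≥ 1`, `ω_v` `L²(μ'ᴺ)`-isometric,
  `dh` left-invariant and finite on compacts): `h ↦ ∫ (ω_v(h·1_N)Φ) conj Φ' dμ'ᴺ` is `dh`-integrable for all `Φ, Φ' ∈ 𝒮(F_vᴺ)` — the local row,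
  at the finitely many «bad» places, of the absolute Euler product of finite matrix coefficients of the rank-one doubled unitary pair
  ([Li1992, §5 p. 206]; the `hF` binder of the cell's ★ `Theorems/H413E2SW2OrbitalSumsReduction`, crux H413, E-2 child line, road C).

KERNEL only: theorems, no definition, no named fact, no `sorry`.  Cell hodgecm-mathlib, FLOOR 0 (`--supports stmt-HodgeConjecture-24833`).
HC_CM is proved only modulo the printed citations until rung 0 closes; nothing here is a claim about them.

## References
* [Li1992] J.-S. Li, J. reine angew. Math. 428 (1992) 177–217 — Thm 2.1 (27) p. 184; §5 p. 206.
* [PlatonovRapinchuk1994] V. Platonov, A. Rapinchuk, *Algebraic Groups and Number Theory* (1994), §6.2 (compactness of anisotropic tori).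
* [BernsteinZelevinsky1976] I. N. Bernstein, A. V. Zelevinsky, Russian Math. Surveys 31 (1976), §2.1 (smooth representations).
-/

set_option autoImplicit false

noncomputable section

open NumberField IsDedekindDomain MeasureTheory Filter Set
open scoped Matrix NNReal Topology ComplexConjugate
open Literature.RepresentationTheory Literature.RepresentationTheory.HeisenbergGroup
open Literature.NumberTheory.Automorphic
open Literature.NumberTheory.Automorphic.UnitaryGroup
open Literature.NumberTheory.Automorphic.Liu2021
open Literature.NumberTheory.GaloisRepresentations.IsNonarchimedeanLocalField

namespace Literature.NumberTheory.GelbartRogawski1991.UnitaryDualPair.LocalSplitting.FinLocalSplittings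

variable {F : Type} [Field F] [NumberField F] {E : Type} [Field E] [NumberField E] [Algebra F E]
  [Algebra.IsQuadraticExtension F E] {c : E ≃ₐ[F] E} {N : ℕ} {δ : E} {hcδ : c δ = -δ} {hδ : δ ≠ 0} {d : F}
  {hd : δ * δ = algebraMap F E d} {T : Matrix (Fin N) (Fin N) F} {hT : T.IsSymm}
  {J : Matrix (Fin N) (Fin N) E} {hJ : J = T.map (algebraMap F E)}
  (𝓢 : FinLocalSplittings F E c N hcδ hδ hd T hT hJ) (J₁ : Matrix (Fin 1) (Fin 1) E) (hJ₁ : J₁ 0 0 ≠ 0)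
  (hTd : IsUnit T.det) (v : HeightOneSpectrum (𝓞 F))

/-- **the local matrix coefficient is CONTINUOUS** (indeed locally constant: `ω_v` is smooth and the centre embedding is continuous).
[cite: BernsteinZelevinsky1976, §2.1] -/
theorem continuous_localCoeff [MeasurableSpace (v.adicCompletion F)] (μ' : Measure (v.adicCompletion F))
    (Φ Φ' : SchwartzBruhat (Fin N → v.adicCompletion F)) :
    Continuous (fun h : localPi E c 1 J₁ v =>
      ∫ x, ((𝓢.omegaLoc v (localCenter E c N J J₁ hJ₁ v h) Φ : SchwartzBruhat (Fin N → v.adicCompletion F)) :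
            (Fin N → v.adicCompletion F) → ℂ) x *
          conj (((Φ' : SchwartzBruhat (Fin N → v.adicCompletion F)) : (Fin N → v.adicCompletion F) → ℂ) x)
          ∂(Measure.pi fun _ : Fin N => μ')) := by
  have hlc : IsLocallyConstant fun h : localPi E c 1 J₁ v => 𝓢.omegaLoc v (localCenter E c N J J₁ hJ₁ v h) Φ :=
    (Representation.IsSmooth.isLocallyConstant_apply (𝓢.omegaLoc v) (𝓢.isSmooth_omegaLoc v) Φ).comp_continuous
      (continuous_localCenter E c N J J₁ hJ₁ v)
  exact (hlc.comp fun Θ : SchwartzBruhat (Fin N → v.adicCompletion F) =>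
    ∫ x, ((Θ : SchwartzBruhat (Fin N → v.adicCompletion F)) : (Fin N → v.adicCompletion F) → ℂ) x *
      conj (((Φ' : SchwartzBruhat (Fin N → v.adicCompletion F)) : (Fin N → v.adicCompletion F) → ℂ) x)
      ∂(Measure.pi fun _ : Fin N => μ')).continuous

/-- **NON-SPLIT places**: `U(J₁)(F_v) = E_v¹` is compact (★ `compactSpace_localPi_one_of_smul_eq`) and the coefficient is continuous, hence
integrable for every measure finite on compacts. [cite: PlatonovRapinchuk1994, §6.2] [cite: Li1992, §5 p. 206] -/
theorem integrable_localCoeff_of_nonsplit (hc : c ≠ 1) (w : PlacesOver E v) (hw : c • w.1 = w.1)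
    [MeasurableSpace (v.adicCompletion F)] (μ' : Measure (v.adicCompletion F))
    [MeasurableSpace (localPi E c 1 J₁ v)] [BorelSpace (localPi E c 1 J₁ v)] (dh : Measure (localPi E c 1 J₁ v))
    [IsFiniteMeasureOnCompacts dh] (Φ Φ' : SchwartzBruhat (Fin N → v.adicCompletion F)) :
    Integrable (fun h : localPi E c 1 J₁ v =>
      ∫ x, ((𝓢.omegaLoc v (localCenter E c N J J₁ hJ₁ v h) Φ : SchwartzBruhat (Fin N → v.adicCompletion F)) :
            (Fin N → v.adicCompletion F) → ℂ) x *
          conj (((Φ' : SchwartzBruhat (Fin N → v.adicCompletion F)) : (Fin N → v.adicCompletion F) → ℂ) x)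
          ∂(Measure.pi fun _ : Fin N => μ')) dh := by
  haveI : CompactSpace (localPi E c 1 J₁ v) := compactSpace_localPi_one_of_smul_eq c J₁ hc hJ₁ w hw
  exact (𝓢.continuous_localCoeff J₁ hJ₁ v μ' Φ Φ').integrable_of_hasCompactSupport
    (IsCompact.of_isClosed_subset isCompact_univ (isClosed_tsupport _) (Set.subset_univ _))

include hTd in
/-- **THE LOCAL MATRIX COEFFICIENTS ARE INTEGRABLE OVER `U(J₁)(F_v)` AT EVERY FINITE PLACE, GENERAL TEST VECTORS** ([Li1992, §5 p. 206]): for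
`c ≠ 1`, `J₁` hermitian with `J₁ 0 0 ≠ 0`, `N ≥ 1`, `ω_v` `L²(μ'ᴺ)`-isometric, every left-invariant measure `dh` finite on compacts and all
`Φ, Φ' ∈ 𝒮(F_vᴺ)`: `h ↦ ∫ (ω_v(h·1_N)Φ) conj Φ' dμ'ᴺ` is `dh`-integrable (split `v`: ★ `integrable_localCoeff_of_split`; non-split `v`: compact torus).
[cite: Li1992, Thm 2.1 (27) p. 184; §5 p. 206] [cite: PlatonovRapinchuk1994, §6.2] -/
theorem integrable_localCoeff [NeZero N] (hc : c ≠ 1) (hJ₁c : (J₁.map c)ᵀ = J₁)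
    [MeasurableSpace (v.adicCompletion F)] [BorelSpace (v.adicCompletion F)] (μ' : Measure (v.adicCompletion F))
    [μ'.IsAddHaarMeasure] (hL2 : (𝓢.omegaLoc v).IsL2Isometric (Measure.pi fun _ : Fin N => μ'))
    [MeasurableSpace (localPi E c 1 J₁ v)] [BorelSpace (localPi E c 1 J₁ v)] (dh : Measure (localPi E c 1 J₁ v))
    [dh.IsMulLeftInvariant] [IsFiniteMeasureOnCompacts dh]
    (Φ Φ' : SchwartzBruhat (Fin N → v.adicCompletion F)) :
    Integrable (fun h : localPi E c 1 J₁ v =>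
      ∫ x, ((𝓢.omegaLoc v (localCenter E c N J J₁ hJ₁ v h) Φ : SchwartzBruhat (Fin N → v.adicCompletion F)) :
            (Fin N → v.adicCompletion F) → ℂ) x *
          conj (((Φ' : SchwartzBruhat (Fin N → v.adicCompletion F)) : (Fin N → v.adicCompletion F) → ℂ) x)
          ∂(Measure.pi fun _ : Fin N => μ')) dh := by
  obtain ⟨w⟩ := (inferInstance : Nonempty (PlacesOver E v))
  by_cases hw : c • w.1 = w.1
  · exact 𝓢.integrable_localCoeff_of_nonsplit J₁ hJ₁ v hc w hw μ' dh Φ Φ'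
  · exact 𝓢.integrable_localCoeff_of_split J₁ hJ₁ hTd v hc hJ₁c w hw μ' hL2 dh Φ Φ'

end Literature.NumberTheory.GelbartRogawski1991.UnitaryDualPair.LocalSplitting.FinLocalSplittings

end
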